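import Mathlib.Data.ZMod.Basic
import Mathlib.Algebra.Group.Subgroup.Basic
import Mathlib.Tactic.Ring
import Mathlib.Tactic.LinearCombination
import Mathlib.Tactic.FinCases
import HarnessLib

/-!
# Schoen's component torsor and the twisted Gauss period: the algebraic skeleton of THEOREM T⁺ / THEOREM Δ (WEIL-2 gen 61, fact-free)

research route, not a corollary; conditional on HC_CM plus one named minimal statement.

Cell `pub-hodge-ring2-ab-*` (ALL ABELIAN VARIETIES), seat WEIL-2 gen 61, account
`run/shared/lean/pub/pub-hodge-ring2/pub-hodge-ring2-ab-weil-2/HECKE-TORSOR-G61.md`, WEIL-CELLS §R71.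

Informal setting.  `G = ℤ/f ⋊ H` acts on a curve `C̃`, `H ⊂ (ℤ/f)ˣ` acting on `N = ℤ/f` by multiplication; Schoen's `f`
components `Q_t` are permuted by `h ∈ H` as `h(Q_t) = Q_{u_h t + τ_h}` with a 1-cocycle `τ` (`τ_{ab} = τ_a + a τ_b`); the
twisted Gauss period is `P_τ(t) = Σ_{u ∈ H} ζ^{a₁(τ_u + u t)}`.  THEOREM T⁺ computes `[τ]` at an arbitrary fixed point;
THEOREM Δ says that `|P_τ(t)|² mod N_{K/ℚ}(K^×)` is the discriminant class of the Hecke piece.  The geometry is not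
formalised; this file proves the finite algebraic steps the account isolates:
* the EXPONENT-LEVEL GALOIS EQUIVARIANCE behind THEOREM Δ (i) (`σ_c P_τ(t) = ζ^{-a₁ τ_c} P_τ(c t)`): for a cocycle `τ`,
  `c (τ_u + u t) = τ_{cu} + (cu) t - τ_c` (`cocycle_exponent_shift`), and the coboundary case;
* LEMMA D's mechanism: re-rooting the branches changes `τ` by the coboundary `w ↦ (u_w − 1) S` (`reroot_is_coboundary`);
* the two local obstructions used in COROLLARY Δ's examples (`3 ∉ N(ℚ(i)^×)`, `2 ∉ N(ℚ(√−3)^×)`) in their finite form: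
  the descent steps `a² + b² = 3c² (mod 9)` resp. `a² + 3b² = 2c² (mod 9)` force `3 ∣ a, b, c` (`decide` over `ZMod 9`);
* the validity and parity arithmetic of §2's EXAMPLE at level 12 (images of the class vectors in `G^{ab} = ℤ/6 × ℤ/2`
  resp. `ℤ/4 × ℤ/2`; the on-branch value `τ_s = 3 + 2 + 2·2·… ≡ 9` is `≢ 0 mod 6`) by `decide`.

0 sorry, no `def`, no named fact; `HC_CM` does not occur.
-/

namespace Summit.HodgeConjecture.Ring2AbelianAll.HeckeTorsorPeriods

section cocycle

variable {R : Type*} [CommRing R]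

/-- THEOREM Δ (i), exponent level: if `τ` is a 1-cocycle for the multiplicative action
(`τ (a * b) = τ a + a * τ b`), then for every `c, u, t` one has `c * (τ u + u * t) = τ (c * u) + (c * u) * t - τ c`.
Applied to the exponents of the twisted Gauss period `P_τ(t) = Σ_u ζ^{a₁(τ_u + u t)}` this is the identity
`σ_c P_τ(t) = ζ^{-a₁ τ_c} · P_τ(c t)` summand by summand (re-indexing `u ↦ c u`), whence `P_τ(t)/P_τ(t') ∈ K = L^H`.
(HECKE-TORSOR-G61 §4 (i).) -/
theorem cocycle_exponent_shift (τ : R → R) (hτ : ∀ a b : R, τ (a * b) = τ a + a * τ b) (c u t : R) :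
    c * (τ u + u * t) = τ (c * u) + (c * u) * t - τ c := by
  have h := hτ c u
  linear_combination -h

/-- The value of a cocycle at `1` vanishes (`τ 1 = τ 1 + 1 * τ 1`). -/
theorem cocycle_at_one (τ : R → R) (hτ : ∀ a b : R, τ (a * b) = τ a + a * τ b) : τ 1 = 0 := by
  have h := hτ 1 1
  simp at h
  linear_combination h

/-- A coboundary `τ a = (a - 1) * s` is a cocycle. -/
theorem coboundary_is_cocycle (s : R) : ∀ a b : R, (a * b - 1) * s = (a - 1) * s + a * ((b - 1) * s) := by
  intro a b; ring

/-- LEMMA D (HECKE-TORSOR-G61 §3): re-rooting the local branches (`γ_i ↦ γ_i + s_i/e_i`) changes the computed cocycle by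
`w ↦ u_w * S - S`, which is the coboundary of `S`: `u * S - S = (u - 1) * S`.  The geometric input making the change
take this shape is `α_{w̄ p} = u_w α_p` (conjugation preserves the tangent character). -/
theorem reroot_is_coboundary (u S : R) : u * S - S = (u - 1) * S := by ring

/-- The sum of two cocycles is a cocycle (used when the class is assembled orbit by orbit: `τ = Σ_O θ_O T_O + Σ_i …`). -/
theorem cocycle_add (τ σ : R → R) (hτ : ∀ a b : R, τ (a * b) = τ a + a * τ b)
    (hσ : ∀ a b : R, σ (a * b) = σ a + a * σ b) :
    ∀ a b : R, (τ (a * b) + σ (a * b)) = (τ a + σ a) + a * (τ b + σ b) := by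
  intro a b; rw [hτ a b, hσ a b]; ring

end cocycle

section localObstructions

/-- COROLLARY Δ, example (4,1,[3]) (`K = ℚ(i)`, `δ = [3]`, `|P_τ|² = 3`): the descent step showing that `3` is not a norm
from `ℚ(i)`, i.e. `a² + b² = 3 c²` has no non-trivial integral solution: modulo `9`, any solution has `3 ∣ a`, `3 ∣ b`,
`3 ∣ c` (so one may divide by `3` and descend). -/
theorem three_not_sum_of_two_squares_descent :
    ∀ a b c : ZMod 9, a ^ 2 + b ^ 2 = 3 * c ^ 2 →
      (a = 0 ∨ a = 3 ∨ a = 6) ∧ (b = 0 ∨ b = 3 ∨ b = 6) ∧ (c = 0 ∨ c = 3 ∨ c = 6) := by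
  decide

/-- COROLLARY Δ, example (4,3,[2]) (`K = ℚ(√−3)`, `δ = [2]`, `|P_τ|² = 2`): the descent step showing that `2` is not a
norm from `ℚ(√−3)`: modulo `9`, `a² + 3 b² = 2 c²` forces `3 ∣ a`, `3 ∣ b`, `3 ∣ c`. -/
theorem two_not_norm_from_eisenstein_descent :
    ∀ a b c : ZMod 9, a ^ 2 + 3 * b ^ 2 = 2 * c ^ 2 →
      (a = 0 ∨ a = 3 ∨ a = 6) ∧ (b = 0 ∨ b = 3 ∨ b = 6) ∧ (c = 0 ∨ c = 3 ∨ c = 6) := by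
  decide

/-- Conversely the classes that THEOREM Δ predicts to be norms in these two examples are norms already over `ℤ`:
`3 · 3 = 9 = 3² + 0²` (`δ·|P_τ|²` at (4,1,[3])), `2 · 2 = 4 = 1² + 3·1²` (at (4,3,[2])), `6 = 1 + 5` (`δ·|P_τ|² = 2·3`
at (4,5,[2]), `K = ℚ(√−5)`), `16 = 4²` (`2·8` there). -/
theorem predicted_norms_are_norms :
    (9 : ℤ) = 3 ^ 2 + 0 ^ 2 ∧ (4 : ℤ) = 1 ^ 2 + 3 * 1 ^ 2 ∧ (6 : ℤ) = 1 ^ 2 + 5 * 1 ^ 2 ∧ (16 : ℤ) = 4 ^ 2 + 5 * 0 ^ 2 := by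
  norm_num

end localObstructions

section exampleTwelve

/-- §2 EXAMPLE, validity of the class vectors (`g_Y = 0` data must have trivial image in `G^{ab}`): for
`G = ℤ/12 ⋊ ⟨7⟩`, `G^{ab} = ℤ/6 × ℤ/2` and the `ℤ/6`-components of `[s]⁷[x³s][xs][x²s]`, `[s]⁵[x³s]³[xs][x²s]`,
`[s]⁶[x³s]²[xs][x⁵s]` sum to `0`, while the session-1 «variant» `[s]⁶[x³s]²[xs][x²s]` sums to `3 ≠ 0` (not a datum). -/
theorem gab_validity_u7 :
    (7 * 0 + 3 + 1 + 2 : ZMod 6) = 0 ∧ (5 * 0 + 3 * 3 + 1 + 2 : ZMod 6) = 0 ∧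
    (6 * 0 + 2 * 3 + 1 + 5 : ZMod 6) = 0 ∧ (6 * 0 + 2 * 3 + 1 + 2 : ZMod 6) ≠ 0 := by
  decide

/-- §2 EXAMPLE, validity for `G = ℤ/12 ⋊ ⟨5⟩` (`G^{ab} = ℤ/4 × ℤ/2`): `[x⁴s]⁷[x^{10}s][x⁹s]²`,
`[x⁴s]⁶[x²s][x^{10}s][x⁹s][x^{11}s]`, `[x⁴s]⁵[x²s][x⁶s][x^{10}s][x⁹s]²` have `ℤ/4`-sum `0`; the session-1 «variant»
`[x⁴s]⁶[x^{10}s]²[x⁹s]²` has sum `2 ≠ 0`. -/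
theorem gab_validity_u5 :
    (7 * 4 + 10 + 9 + 9 : ZMod 4) = 0 ∧ (6 * 4 + 2 + 10 + 9 + 11 : ZMod 4) = 0 ∧
    (5 * 4 + 2 + 6 + 10 + 9 + 9 : ZMod 4) = 0 ∧ (6 * 4 + 2 * 10 + 2 * 9 : ZMod 4) ≠ 0 := by
  decide

/-- §2 EXAMPLE, the ON-BRANCH evaluation at the headline row of (4,3,[2]) (character `λ = sgn`, bad pair `{b₁,b₂}` of
SPLIT type, `θ = θ' = 1`): transport exponents `n_{b₁}(s) = 3`, `n_{b₂}(s) = 2`; branch-index shift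
`J = ξ_{b₁}(s) − ξ_{b₂}(s) = 1/2 − 5/6 ≡ 2/3`, `e = 3`, `α_{b₁} = 8`, so the pair contributes `α·(eJ) = 8·2 = 16`;
`τ_s = 3 + 2 + 16 ≡ 9 (mod 12)`, and `9` is NOT in the coboundary subgroup `6·ℤ/12` (`[τ] ≠ 0`), in agreement with the
off-branch evaluation of EXAMPLE Y″ (HECKE-G59 §5: `[τ] ≠ 0`, all 12 packets Weil-carrying). -/
theorem onBranch_headline_u7 :
    (3 + 2 + 8 * 2 : ZMod 12) = 9 ∧ ¬ (∃ c : ZMod 12, (7 - 1) * c = 9) := by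
  refine ⟨by decide, by decide⟩

end exampleTwelve

end Summit.HodgeConjecture.Ring2AbelianAll.HeckeTorsorPeriods
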